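/-
Copyright (c) 2026 the pub-hodgecm-mathlib formalisation cell (harness21).  Prover seat hodgecm-mathlib-F0P2-p08 (g2), Track B «K2-LIT»,
#184♮ = hLiu418 = `stmt-HodgeConjecture-24832`; socket #41 `sig_K2LiuSiegelEisensteinContinuation`, KIND W — LEAD F0P6-plan (g14) BATCH #62 (1) «(x-a)»:
editions 1–2 (desk re-cut 22:15:21Z): the BY-VALUE letter `U(S,h)` of ★ `K2LiuSiegelEisensteinWhittakerFactorLetters` (p862052 ∕ p862137) and the `T`-part `I_T(S,s,h)` AS
DECLARATIONS, and (W1) the Euler identity on the half-plane of convergence reduced to ★ G1 `whittakerDelta_eq_mul_tprod_euler` + ★ G2 `tprod_whittaker_of_vol_eq_one` + ONE per-place letter.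
-/
import Summits.HodgeConjecture.HodgeConjecture.Theorems.K2LiuWhittakerDeltaEulerProduct        -- ★ G1 `whittakerDelta_eq_mul_tprod_euler` (+ ★ (d1) `exists_finset_forall_integral`)
import Summits.HodgeConjecture.HodgeConjecture.Theorems.K2LiuGoodPlaceWhittakerEulerAssembly   -- ★ G2 `tprod_whittaker_of_vol_eq_one`, `partialStandardL`, `quadraticHeckeCharCM`
import Summits.HodgeConjecture.HodgeConjecture.Theorems.K2LiuSiegelEisensteinKindWPartFubini     -- ★ p862531 `jointWhittaker_eq_sum_mul_prod_of_sum_tensor` (ED. 2)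
import HarnessLib

/-!
# Crux `HLiu418`, socket #41, KIND W — `K2LiuSiegelEisensteinKindWLetters` (edition 1): THE EXCEPTIONAL PLACE SET `U(S,h)` AND THE `T`-PART `I_T(S,s,h)` AS
# DECLARATIONS, AND (W1) THE EULER IDENTITY `W_S(f_s)(h) = I_{U(S,h)}(S,s,h) · (b^{U(S,h)}(s))⁻¹` ON THE HALF-PLANE OF CONVERGENCE

Cell `hodgecm-mathlib`, crux item hLiu418 = `stmt-HodgeConjecture-24832`, route of record `HCCMUnconditional`; squad K2 ∕ K2Liu, road `K2_Liu`, socket #41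
`sig_K2LiuSiegelEisensteinContinuation` (TOP ED. 15 ★ p862237 `K2LiuSiegelEisensteinContinuationTopFifteen`, KIND-W binder block :176–196); LEAD F0P6-plan (g14)
BATCH #62 (1): «(x) KIND-W IS SPLIT BY LINEAGE — (x-a) F0P2-p08 (g2): the concrete `U S h := T(S,h)` and `A S s h := I_{T(S,h)}(S,s,h)` AS DECLS + (W1) + (W2);
(x-b) K2E4-p10 (g9): the analytic half (W3) over (x-a)'s `A`»; RE-CUT by the desk ruling 22:15:21Z ∕ BATCH #66 (4) (`A` ∃-bound = the continued `T`-part; this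
edition 1 = the `s`-free letter `U`, the convergence-half-plane object `I_T` and (W1) there).  DEFINITIONS + THEOREMS (no `instance`, no `notation`, no named-fact hypothesis, no `sorry`);
lane `--supports stmt-HodgeConjecture-24832` (count-neutral helper; closes no socket by itself).

THE LETTERS (F0P2-p08 (g0) census `F0/P2/F0P2-p08/g0/CENSUS-KINDW-FactorLetters.F0P2-p08-g0.md` §1, now typed).  For a Fourier index `S ∈ M_n(L)` and `h ∈ H(𝔸)`:
* §1 **`kindWPlaces T₀ S h`** `= T₀ ∪ {v : h_v ∉ K_{H,v}} ∪ {v : (w_Δ)_v ∉ K_{H,v}} ∪ D(S)`, `D(S) = {v : some entry of S or of S⁻¹ is not integral above v}` — the EXCEPTIONAL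
  PLACE SET `U(S,h)` (`T₀` = the datum's bad set: `v ∣ 2`, ramification of `L∕L⁺` and of `χ`, non-units of `δ`, non-hyperspecial places of `𝒦`, … — a PARAMETER).  It is
  FINITE for every `S` and `h` as soon as `T₀` is (`kindWPlaces_finite`: ★ `UnitaryGroup.eventually_evalPlace_mem_localInt` for `h` and `w_Δ`, ★ (d1)
  `exists_finset_forall_integral` for `S` and `S⁻¹`); `kindWFinset T₀ S h` is the same set as a `Finset`; off it `h_v, (w_Δ)_v ∈ K_{H,v}`, `S` and `S⁻¹` are
  integral above `v`, and `v ∉ T₀` (§1 membership lemmas = ★ G1's letters `hh`, `hw`, `hS` and the unimodularity input of the per-place glue ★ `integral_unipDeltaLoc_lambdaLoc_eq`).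
* §2 **`kindWPart T νinf νv fT S s h`** `= I_T(S,s,h) = ∫ [conj ψ_S(p_∞,1) · ∏_{v∈T} conj ψ_S(ι_v p_v)] · fT_s(w_Δ p_∞ h_∞, (w_Δ p_v h_v)_{v∈T}) d(ν_∞ ⊗ ⊗_{v∈T} ν_v)` —
  ★ G1's joint archimedean × `T` Whittaker integral VERBATIM, the Whittaker–Euler data (`νinf` = ★ Φ3c's archimedean factor for the splitting at `T`, `νv` = the local
  Haar measures with `ν_v(K_{H,v} ∩ N_Δ(L⁺_v)) = 1`, `fT` = ★ #31s' factorisation of the standard family off `T`) being PARAMETERS (no `Classical.choose`).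
  DESK RULING (K2E5-p17 (g8) 2026-09-04T22:15:21Z on K2E4-p10 (g9) 22:14:59Z, LEAD BATCH #66 (4)): `kindWPart` is the CONVERGENCE-HALF-PLANE IDENTITY OBJECT ONLY —
  a literal Bochner integral is `0` off integrability (the rank-two archimedean Whittaker integrand converges only for `re s > 1∕2`, ★ Φ6b-1), so it is NOT the
  TOP's continued letter `A` on `{0 < re s}`; the TOP's `A` is ∃-bound (the CONTINUED `T`-part, edition 2 `exists_kindW_eulerLetters`), and equals `kindWPart`
  on the half-plane of convergence by §3.  The TOP's `U := fun S h => kindWPlaces ↑T₀ ↑S h` (type of TOP :177–178 on the nose).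
* §3 **(W1) `whittakerDelta_eq_kindWPart_mul`** — for `0 < re s`: ★ G1 at `T := kindWFinset T₀ S h` (its letters `hh hw hS hχ` DISCHARGED by §1, `hνK hmap hfac` taken for
  every finite `T ⊇ T₀` as the Whittaker–Euler data's specification, `hG` = ★ O41.3's integrability BY VALUE) × ★ G2 `tprod_whittaker_of_vol_eq_one` at
  `U := kindWPlaces ↑T₀ S h`, fed by ONE per-place letter `hJ` («`∫ conj ψ_S(ι_v y)·Λ_{s,v}((w_Δ)_v y) dν_v = (1 − q_v^{−(2s+1)})(1 − ε(ϖ_v) q_v^{−(2s+2)})` for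
  `v ∉ U(S,h)`» = ★ `K2LiuGoodPlaceLocalFactor.integral_unipDeltaLoc_lambdaLoc_eq` per place, the (W1b) edition discharges it):
  **`W_S(f_s)(h) = I_{U(S,h)}(S,s,h) · (ζ^{U}_{L⁺}(2s+1) · L^{U}(2s+2, ε_{L∕L⁺}))⁻¹`, `U = kindWPlaces ↑T₀ S h`** — the TOP's `hEuler` right-hand side at `(S, s, h)` with the
  `T`-part read as the joint integral (edition 2 replaces it by the continued `A`, equal to it where ★ G1's `hG` holds).
* §4 (ED. 2) **`whittakerDelta_eq_sum_mul_prod_mul`** — (W1) ∘ FUBINI (★ p862531 `jointWhittaker_eq_sum_mul_prod_of_sum_tensor`): when the `T`-part at `T = U(S,h)` is a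
  finite sum of pure tensors `fT_s(a,x) = Σ_j F_{∞,j}(s)(a)·∏_{v∈T} F_{v,j}(s)(x_v)` (K-finite standard family; `hsum`) with integrable summands (`hint`),
  **`W_S(f_s)(h) = (Σ_j W_{S,∞,j}(s,h_∞) · ∏_{v∈U(S,h)} W_{S,v,j}(s,h_v)) · (b^{U(S,h)}(s))⁻¹`** — the Σ∏ PRESENTATION of KIND W on the half-plane of convergence, by local
  Whittaker INTEGRALS (edition 3 ∕ (x-b): replace each by its continued function, ★ junction ∕ ★ Φ5–G3 ∕ ★ GoodPlaceWhittaker*).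
NOT HERE ((x-a) edition 3 ∕ (x-b)): the ∃-head `exists_kindW_eulerLetters` (continued `T`-part from the ★ per-place continued local Whittaker functions, Fubini of
`kindWPart` into local integrals, «continued = integral» per place, holomorphy (W2)); the per-place discharge of `hJ`; (W3) `hdec`, `hsupp` (K2E4-p10 (g9)
`K2LiuSiegelEisensteinKindWInstance`).
HONEST LABEL.  Count-neutral helper; it retires nothing by itself: `HC_CM` is proved only modulo the 7 printed citations (2 remaining named inputs:
hLiu418 = `stmt-HodgeConjecture-24832`, h413 = `stmt-HodgeConjecture-24833`) until rung 0 closes.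

## References
* [KudlaRallis1994] S. Kudla, S. Rallis, *A regularized Siegel–Weil formula: the first term identity*, Ann. of Math. 140 (1994): §1 (Euler product of the
  non-singular Fourier coefficients off a finite set of places).
* [Tan1999] V. Tan, Canad. J. Math. 51 (1999): §2–§3 (`W_β = W_{β,S} · ∏_{v∉S} W_{β,v}`).   * [Liu2011] Y. Liu, Algebra Number Theory 5 (2011): §2A (2-10), §2B p. 862.
* [CasselsFrohlichANT1967] Cassels–Fröhlich (eds.), *Algebraic Number Theory* (1967): Ch. XV (Tate) §3.1, Lemma 3.2.1, Thm. 3.3.1.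
* [Shimura1997] G. Shimura, *Euler products and Eisenstein series*, CBMS 93 (1997): §18.1 (18.4), §18.3.
-/

set_option autoImplicit false
-- the mandated namespace repeats the single-problem summit's segment (`HodgeConjecture.HodgeConjecture`)
set_option linter.dupNamespace false

noncomputable section

open scoped Matrix RestrictedProduct ENNReal NNReal Topology ComplexConjugate
open NumberField IsDedekindDomain MeasureTheory Measure Filter Set

namespace Summit.HodgeConjecture.HodgeConjecture.Cruxes.HLiu418.K2LiuSiegelEisensteinKindWLetters

open Literature.NumberTheory.Automorphic Literature.NumberTheory.GaloisRepresentations Literature.NumberTheory.LFunctions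
open Literature.NumberTheory.GelbartRogawski1991 Literature.NumberTheory.GelbartRogawski1991.GRConstruction
open Literature.NumberTheory.K2Lit.SiegelDoubled
open Literature.NumberTheory.K2Lit.PlaceSplitting
open Literature.MeasureTheory.RestrictedProduct
open Literature.Topology.Algebra.RestrictedProduct (inH)
open Summit.HodgeConjecture.HodgeConjecture.Cruxes.HLiu418.K2LiuSiegelUnipotentLocalDefs
open Summit.HodgeConjecture.HodgeConjecture.Cruxes.HLiu418.K2LiuSiegelUnipotentSplitDefs
open Summit.HodgeConjecture.HodgeConjecture.Cruxes.HLiu418.K2LiuSiegelUnipotentSplitAtDefs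
open Summit.HodgeConjecture.HodgeConjecture.Cruxes.HLiu418.K2LiuSiegelUnipotentHaarPinned
open Summit.HodgeConjecture.HodgeConjecture.Cruxes.HLiu418.K2LiuSiegelUnipotentEulerProduct
open Summit.HodgeConjecture.HodgeConjecture.Cruxes.HLiu418.K2LiuSiegelUnipotentFourierDefs
open Summit.HodgeConjecture.HodgeConjecture.Cruxes.HLiu418.K2LiuWhittakerDeltaEulerHead
open Summit.HodgeConjecture.HodgeConjecture.Cruxes.HLiu418.K2LiuWhittakerDeltaEulerProduct
open Summit.HodgeConjecture.HodgeConjecture.Cruxes.HLiu418.K2LiuSiegelUnipotentCharacterFactorisation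
open Summit.HodgeConjecture.HodgeConjecture.Cruxes.HLiu418.K2LiuGoodPlaceWhittakerEulerAssembly
open Summit.HodgeConjecture.HodgeConjecture.Cruxes.HLiu418.K2LiuSiegelEisensteinKindWPartFubini (jointWhittaker_eq_sum_mul_prod_of_sum_tensor)

variable (L : Type) [Field L] [NumberField L] [IsCMField L]
variable {N M n : ℕ} (e : Fin N × Fin M ≃ Fin n)
  (dV : Fin N → L) (hdV : ∀ i, IsCMField.complexConj L (dV i) = dV i)
  (dW : Fin M → L) (hdW : ∀ i, IsCMField.complexConj L (dW i) = dW i)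

/-! ## §1 The exceptional place set `U(S,h) = T₀ ∪ {h_v ∉ K_v} ∪ {(w_Δ)_v ∉ K_v} ∪ D(S)` -/

/-- **THE KIND-W EXCEPTIONAL PLACE SET `U(S,h)`** (letter `U` of ★ `K2LiuSiegelEisensteinWhittakerFactorLetters`): the datum's bad set `T₀`, the places where `h` or the
Weyl element `w_Δ` is not hyperspecial-integral, and `D(S)` = the places above which some entry of `S` or of `S⁻¹` is not integral.
[cite: KudlaRallis1994, §1] [cite: Tan1999, §2] -/
def kindWPlaces (T₀ : Set (HeightOneSpectrum (𝓞 (Fp L)))) (S : Matrix (Fin n) (Fin n) L) (h : HA L e dV hdV dW hdW) :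
    Set (HeightOneSpectrum (𝓞 (Fp L))) :=
  (((T₀ ∪
    {v | UnitaryGroup.evalPlace (Fp L) L (IsCMField.complexConj L) (n + n) (hermD L e dV hdV dW hdW) v
        (UnitaryGroup.finPart (Fp L) L (IsCMField.complexConj L) (n + n) (hermD L e dV hdV dW hdW) h) ∉
      UnitaryGroup.localInt L (IsCMField.complexConj L) (n + n) (hermD L e dV hdV dW hdW) v}) ∪
    {v | UnitaryGroup.evalPlace (Fp L) L (IsCMField.complexConj L) (n + n) (hermD L e dV hdV dW hdW) v
        (UnitaryGroup.finPart (Fp L) L (IsCMField.complexConj L) (n + n) (hermD L e dV hdV dW hdW) (weylDelta L e dV hdV dW hdW)) ∉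
      UnitaryGroup.localInt L (IsCMField.complexConj L) (n + n) (hermD L e dV hdV dW hdW) v}) ∪
    {v | ∃ (w : UnitaryGroup.PlacesOver L v) (i j : Fin n), ((S i j : L) : w.1.adicCompletion L) ∉ w.1.adicCompletionIntegers L}) ∪
    {v | ∃ (w : UnitaryGroup.PlacesOver L v) (i j : Fin n), ((S⁻¹ i j : L) : w.1.adicCompletion L) ∉ w.1.adicCompletionIntegers L}

section Places

variable {T₀ : Set (HeightOneSpectrum (𝓞 (Fp L)))} {S : Matrix (Fin n) (Fin n) L} {h : HA L e dV hdV dW hdW} {v : HeightOneSpectrum (𝓞 (Fp L))}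

/-- `T₀ ⊆ U(S,h)`. [folklore] -/
theorem subset_kindWPlaces : T₀ ⊆ kindWPlaces L e dV hdV dW hdW T₀ S h := fun _ hv =>
  Or.inl (Or.inl (Or.inl (Or.inl hv)))

/-- off `U(S,h)`, `v ∉ T₀`. [folklore] -/
theorem not_mem_of_not_mem_kindWPlaces (hv : v ∉ kindWPlaces L e dV hdV dW hdW T₀ S h) : v ∉ T₀ := fun h' =>
  hv (subset_kindWPlaces L e dV hdV dW hdW h')

/-- off `U(S,h)`, `h_v ∈ K_{H,v}` (★ G1's letter `hh`). [cite: CasselsFrohlichANT1967, Ch. XV §3.1] -/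
theorem evalPlace_mem_localInt_of_not_mem_kindWPlaces (hv : v ∉ kindWPlaces L e dV hdV dW hdW T₀ S h) :
    UnitaryGroup.evalPlace (Fp L) L (IsCMField.complexConj L) (n + n) (hermD L e dV hdV dW hdW) v
        (UnitaryGroup.finPart (Fp L) L (IsCMField.complexConj L) (n + n) (hermD L e dV hdV dW hdW) h) ∈
      UnitaryGroup.localInt L (IsCMField.complexConj L) (n + n) (hermD L e dV hdV dW hdW) v := by
  by_contra h'
  exact hv (Or.inl (Or.inl (Or.inl (Or.inr h'))))

/-- off `U(S,h)`, `(w_Δ)_v ∈ K_{H,v}` (★ G1's letter `hw`). [cite: CasselsFrohlichANT1967, Ch. XV §3.1] -/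
theorem weylDelta_mem_localInt_of_not_mem_kindWPlaces (hv : v ∉ kindWPlaces L e dV hdV dW hdW T₀ S h) :
    UnitaryGroup.evalPlace (Fp L) L (IsCMField.complexConj L) (n + n) (hermD L e dV hdV dW hdW) v
        (UnitaryGroup.finPart (Fp L) L (IsCMField.complexConj L) (n + n) (hermD L e dV hdV dW hdW) (weylDelta L e dV hdV dW hdW)) ∈
      UnitaryGroup.localInt L (IsCMField.complexConj L) (n + n) (hermD L e dV hdV dW hdW) v := by
  by_contra h'
  exact hv (Or.inl (Or.inl (Or.inr h')))

/-- off `U(S,h)`, every entry of `S` is integral above `v` (★ G1's letter `hS`). [cite: CasselsFrohlichANT1967, Ch. XV §3.1] -/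
theorem integral_of_not_mem_kindWPlaces (hv : v ∉ kindWPlaces L e dV hdV dW hdW T₀ S h) (w : UnitaryGroup.PlacesOver L v) (i j : Fin n) :
    ((S i j : L) : w.1.adicCompletion L) ∈ w.1.adicCompletionIntegers L := by
  by_contra h'
  exact hv (Or.inl (Or.inr ⟨w, i, j, h'⟩))

/-- off `U(S,h)`, every entry of `S⁻¹` is integral above `v` (with the previous lemma: `S` is `v`-UNIMODULAR — the input of the per-place glue
★ `integral_unipDeltaLoc_lambdaLoc_eq`). [cite: Shimura1997, §18.1] -/
theorem inv_integral_of_not_mem_kindWPlaces (hv : v ∉ kindWPlaces L e dV hdV dW hdW T₀ S h) (w : UnitaryGroup.PlacesOver L v) (i j : Fin n) :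
    ((S⁻¹ i j : L) : w.1.adicCompletion L) ∈ w.1.adicCompletionIntegers L := by
  by_contra h'
  exact hv (Or.inr ⟨w, i, j, h'⟩)

/-- **`U(S,h)` IS FINITE** whenever `T₀` is: almost all components of the adelic points `h`, `w_Δ` are hyperspecial-integral (★ `eventually_evalPlace_mem_localInt`) and the
entries of `S`, `S⁻¹` are integral above almost every place (★ (d1) `exists_finset_forall_integral`). [cite: CasselsFrohlichANT1967, Ch. XV (Tate) §3.1] -/
theorem kindWPlaces_finite (hT₀ : T₀.Finite) (S : Matrix (Fin n) (Fin n) L) (h : HA L e dV hdV dW hdW) :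
    (kindWPlaces L e dV hdV dW hdW T₀ S h).Finite := by
  classical
  refine (((hT₀.union ?_).union ?_).union ?_).union ?_
  · exact Filter.eventually_cofinite.1 (UnitaryGroup.eventually_evalPlace_mem_localInt (Fp L) L (IsCMField.complexConj L) (n + n) (hermD L e dV hdV dW hdW)
      (UnitaryGroup.finPart (Fp L) L (IsCMField.complexConj L) (n + n) (hermD L e dV hdV dW hdW) h))
  · exact Filter.eventually_cofinite.1 (UnitaryGroup.eventually_evalPlace_mem_localInt (Fp L) L (IsCMField.complexConj L) (n + n) (hermD L e dV hdV dW hdW)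
      (UnitaryGroup.finPart (Fp L) L (IsCMField.complexConj L) (n + n) (hermD L e dV hdV dW hdW) (weylDelta L e dV hdV dW hdW)))
  · obtain ⟨T₁, hT₁⟩ := exists_finset_forall_integral L S
    refine (T₁ : Set (HeightOneSpectrum (𝓞 (Fp L)))).toFinite.subset ?_
    rintro v ⟨w, i, j, hw⟩
    by_contra hv
    exact hw (hT₁ v (fun hv' => hv (Finset.mem_coe.2 hv')) w i j)
  · obtain ⟨T₁, hT₁⟩ := exists_finset_forall_integral L S⁻¹
    refine (T₁ : Set (HeightOneSpectrum (𝓞 (Fp L)))).toFinite.subset ?_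
    rintro v ⟨w, i, j, hw⟩
    by_contra hv
    exact hw (hT₁ v (fun hv' => hv (Finset.mem_coe.2 hv')) w i j)

end Places

/-- **`U(S,h)` AS A `Finset`** (the `T` at which ★ G1 is applied): `kindWFinset T₀ S h = kindWPlaces ↑T₀ S h` as sets (`coe_kindWFinset`). [folklore] -/
def kindWFinset (T₀ : Finset (HeightOneSpectrum (𝓞 (Fp L)))) (S : Matrix (Fin n) (Fin n) L) (h : HA L e dV hdV dW hdW) :
    Finset (HeightOneSpectrum (𝓞 (Fp L))) :=
  (kindWPlaces_finite L e dV hdV dW hdW (Finset.finite_toSet T₀) S h).toFinset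

/-- `↑(kindWFinset T₀ S h) = kindWPlaces ↑T₀ S h`. [folklore] -/
theorem coe_kindWFinset (T₀ : Finset (HeightOneSpectrum (𝓞 (Fp L)))) (S : Matrix (Fin n) (Fin n) L) (h : HA L e dV hdV dW hdW) :
    ((kindWFinset L e dV hdV dW hdW T₀ S h : Finset (HeightOneSpectrum (𝓞 (Fp L)))) : Set (HeightOneSpectrum (𝓞 (Fp L)))) =
      kindWPlaces L e dV hdV dW hdW (T₀ : Set (HeightOneSpectrum (𝓞 (Fp L)))) S h :=
  Set.Finite.coe_toFinset _

/-- `v ∈ kindWFinset T₀ S h ↔ v ∈ kindWPlaces ↑T₀ S h`. [folklore] -/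
theorem mem_kindWFinset {T₀ : Finset (HeightOneSpectrum (𝓞 (Fp L)))} {S : Matrix (Fin n) (Fin n) L} {h : HA L e dV hdV dW hdW} {v : HeightOneSpectrum (𝓞 (Fp L))} :
    v ∈ kindWFinset L e dV hdV dW hdW T₀ S h ↔ v ∈ kindWPlaces L e dV hdV dW hdW (T₀ : Set (HeightOneSpectrum (𝓞 (Fp L)))) S h :=
  Set.Finite.mem_toFinset _

/-- `T₀ ⊆ kindWFinset T₀ S h`. [folklore] -/
theorem subset_kindWFinset (T₀ : Finset (HeightOneSpectrum (𝓞 (Fp L)))) (S : Matrix (Fin n) (Fin n) L) (h : HA L e dV hdV dW hdW) :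
    T₀ ⊆ kindWFinset L e dV hdV dW hdW T₀ S h := fun _ hv =>
  (mem_kindWFinset L e dV hdV dW hdW).2 (subset_kindWPlaces L e dV hdV dW hdW (Finset.mem_coe.2 hv))

/-! ## §2 The `T`-part `I_T(S,s,h)`: ★ G1's joint archimedean × `T` Whittaker integral -/

section Part

variable [MeasurableSpace ↥(unipDeltaArch L e dV hdV dW hdW)]
  [∀ v : HeightOneSpectrum (𝓞 (Fp L)), MeasurableSpace ↥(unipDeltaLoc L e dV hdV dW hdW v)]

/-- **THE `T`-PART `I_T(S,s,h)` ON THE HALF-PLANE OF CONVERGENCE** (the value of the continued letter `A` of ★ `K2LiuSiegelEisensteinWhittakerFactorLetters` wherever the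
global Whittaker integrand is integrable; a literal Bochner integral, `0` off integrability — NOT the continued letter itself, desk ruling 22:15:21Z): ★ G1
`whittakerDelta_eq_mul_tprod_euler`'s joint archimedean × `T` Whittaker integral of the `T`-part `fT` of a factorizable family, VERBATIM —
`∫ [conj ψ_S(p_∞,1) · ∏_{v∈T} conj ψ_S(ι_v p_v)] · fT_s(w_Δ p_∞ h_∞, (w_Δ p_v h_v)_{v∈T}) d(ν_∞ ⊗ ⊗_{v∈T} ν_v)`. [cite: KudlaRallis1994, §1] [cite: Tan1999, §2–§3] -/
def kindWPart (T : Finset (HeightOneSpectrum (𝓞 (Fp L)))) (νinf : Measure ↥(unipDeltaArch L e dV hdV dW hdW))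
    (νv : ∀ v : HeightOneSpectrum (𝓞 (Fp L)), Measure ↥(unipDeltaLoc L e dV hdV dW hdW v))
    (fT : ℂ → UnitaryGroup.arch (Fp L) L (IsCMField.complexConj L) (n + n) (hermD L e dV hdV dW hdW) ×
      (Π v : T, UnitaryGroup.localPi L (IsCMField.complexConj L) (n + n) (hermD L e dV hdV dW hdW) v.1) → ℂ)
    (S : Matrix (Fin n) (Fin n) L) (s : ℂ) (h : HA L e dV hdV dW hdW) : ℂ :=
  ∫ p, (conj (unipDeltaChar L e dV hdV dW hdW S
          (UnitaryGroup.archToAdelic (Fp L) L (IsCMField.complexConj L) (n + n) (hermD L e dV hdV dW hdW)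
            (p.1 : UnitaryGroup.arch (Fp L) L (IsCMField.complexConj L) (n + n) (hermD L e dV hdV dW hdW))) : ℂ) *
        ∏ v : T, conj (unipDeltaChar L e dV hdV dW hdW S
          (locToAdelic L e dV hdV dW hdW v.1
            ((p.2 v : ↥(unipDeltaLoc L e dV hdV dW hdW v.1)) : UnitaryGroup.localPi L (IsCMField.complexConj L) (n + n) (hermD L e dV hdV dW hdW) v.1)) : ℂ)) *
      fT s (UnitaryGroup.archPart (Fp L) L (IsCMField.complexConj L) (n + n) (hermD L e dV hdV dW hdW) (weylDelta L e dV hdV dW hdW) *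
            (p.1 : UnitaryGroup.arch (Fp L) L (IsCMField.complexConj L) (n + n) (hermD L e dV hdV dW hdW)) *
            UnitaryGroup.archPart (Fp L) L (IsCMField.complexConj L) (n + n) (hermD L e dV hdV dW hdW) h,
          fun v : T => UnitaryGroup.evalPlace (Fp L) L (IsCMField.complexConj L) (n + n) (hermD L e dV hdV dW hdW) v.1
              (UnitaryGroup.finPart (Fp L) L (IsCMField.complexConj L) (n + n) (hermD L e dV hdV dW hdW) (weylDelta L e dV hdV dW hdW)) *
            ((p.2 v : ↥(unipDeltaLoc L e dV hdV dW hdW v.1)) : UnitaryGroup.localPi L (IsCMField.complexConj L) (n + n) (hermD L e dV hdV dW hdW) v.1) *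
            UnitaryGroup.evalPlace (Fp L) L (IsCMField.complexConj L) (n + n) (hermD L e dV hdV dW hdW) v.1
              (UnitaryGroup.finPart (Fp L) L (IsCMField.complexConj L) (n + n) (hermD L e dV hdV dW hdW) h))
      ∂(νinf.prod (Measure.pi fun v : T => νv v.1))

end Part

/-! ## §3 (W1) THE EULER IDENTITY `W_S(f_s)(h) = I_{U(S,h)}(S,s,h) · (b^{U(S,h)}(s))⁻¹` on the half-plane of convergence -/

section Euler

variable [DecidableEq (HeightOneSpectrum (𝓞 (Fp L)))]
  [MeasurableSpace ↥(unipDelta L e dV hdV dW hdW)] [BorelSpace ↥(unipDelta L e dV hdV dW hdW)]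
  [MeasurableSpace ↥(unipDeltaArch L e dV hdV dW hdW)] [BorelSpace ↥(unipDeltaArch L e dV hdV dW hdW)]
  [∀ v : HeightOneSpectrum (𝓞 (Fp L)), MeasurableSpace ↥(unipDeltaLoc L e dV hdV dW hdW v)] [∀ v : HeightOneSpectrum (𝓞 (Fp L)), BorelSpace ↥(unipDeltaLoc L e dV hdV dW hdW v)]

set_option maxHeartbeats 800000 in -- MEASURED (as ★ G1 `whittakerDelta_eq_mul_tprod_euler`, whose statement this one repeats: default 200 000 times out at `whnf` of the statement): the adelic doubled unitary datum + the Haar∕Borel tower; plain `rw`, no search tactics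
/-- **(W1) THE EULER IDENTITY OF KIND W — `W_S(f_s)(h) = I_{U(S,h)}(S,s,h) · (ζ^U_{L⁺}(2s+1) · L^U(2s+2, ε_{L∕L⁺}))⁻¹`, `U = U(S,h)`** (the TOP's `hEuler` right-hand side at
`(S, s, h)`, the `T`-part read as ★ G1's joint integral `kindWPart`; wherever `hG` holds — ★ O41.3: `{n∕2 < re s}` — this IS the value of the continued `T`-part).
INPUTS: the Whittaker–Euler data's specification for every finite `T` (`hνK`: `ν_v(K_{H,v} ∩ N_Δ(L⁺_v)) = 1`; `hmap`: ★ Φ3c's pin of `νN` along the splitting at `T`;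
`hfac`: ★ #31s — the standard family factorises off every finite `T ⊇ T₀`); `χ` unramified off `T₀`; `0 < re s`; the integrability `hG` of the global Whittaker
integrand (★ O41.3); and ONE per-place letter `hJ` off `U(S,h)` (★ `K2LiuGoodPlaceLocalFactor.integral_unipDeltaLoc_lambdaLoc_eq`, `ν_v`-normalised).  PROOF: ★ G1
`whittakerDelta_eq_mul_tprod_euler` at `T := kindWFinset T₀ S h` (letters `hh hw hS hχ` from §1) and ★ G2 `tprod_whittaker_of_vol_eq_one` at `U := kindWPlaces ↑T₀ S h`.
[cite: KudlaRallis1994, §1] [cite: Tan1999, §2–§3] [cite: Liu2011, §2A (2-10)] [cite: CasselsFrohlichANT1967, Ch. XV Thm. 3.3.1] -/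
theorem whittakerDelta_eq_kindWPart_mul (T₀ : Finset (HeightOneSpectrum (𝓞 (Fp L))))
    (νN : Measure ↥(unipDelta L e dV hdV dW hdW))
    (νv : ∀ v : HeightOneSpectrum (𝓞 (Fp L)), Measure ↥(unipDeltaLoc L e dV hdV dW hdW v)) [∀ v, (νv v).IsHaarMeasure] [∀ v, SigmaFinite (νv v)]
    (hνK : ∀ v, νv v (((inH (fun v => UnitaryGroup.localInt L (IsCMField.complexConj L) (n + n) (hermD L e dV hdV dW hdW) v)
      (fun v => unipDeltaLoc L e dV hdV dW hdW v) v) : Subgroup ↥(unipDeltaLoc L e dV hdV dW hdW v)) : Set ↥(unipDeltaLoc L e dV hdV dW hdW v)) = 1)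
    (νinf : Finset (HeightOneSpectrum (𝓞 (Fp L))) → Measure ↥(unipDeltaArch L e dV hdV dW hdW)) (hσ : ∀ T, SigmaFinite (νinf T))
    (hmap : ∀ T : Finset (HeightOneSpectrum (𝓞 (Fp L))), Measure.map (unipDeltaSplitAt L e dV hdV dW hdW T) νN =
      (νinf T).prod ((Measure.pi fun v : T => νv v.1).prod
        (rpMeasure (fun v : {v : HeightOneSpectrum (𝓞 (Fp L)) // v ∉ T} => ((inH (fun v => UnitaryGroup.localInt L (IsCMField.complexConj L) (n + n) (hermD L e dV hdV dW hdW) v)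
          (fun v => unipDeltaLoc L e dV hdV dW hdW v) v.1 : Subgroup ↥(unipDeltaLoc L e dV hdV dW hdW v.1)) : Set ↥(unipDeltaLoc L e dV hdV dW hdW v.1))) (fun v => νv v.1) ∅)))
    {χ : HeckeCharacter L} (hχ : ∀ v, v ∉ T₀ → ∀ w' : UnitaryGroup.PlacesOver L v, χ.IsUnramifiedAt w'.1)
    {f : ℂ → HA L e dV hdV dW hdW → ℂ}
    {fT : ∀ T : Finset (HeightOneSpectrum (𝓞 (Fp L))), ℂ → UnitaryGroup.arch (Fp L) L (IsCMField.complexConj L) (n + n) (hermD L e dV hdV dW hdW) ×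
      (Π v : T, UnitaryGroup.localPi L (IsCMField.complexConj L) (n + n) (hermD L e dV hdV dW hdW) v.1) → ℂ}
    (hfac : ∀ T : Finset (HeightOneSpectrum (𝓞 (Fp L))), T₀ ⊆ T → IsFactorizableOff L e dV hdV dW hdW T χ f (fT T))
    (S : Matrix (Fin n) (Fin n) L) {s : ℂ} (hs : 0 < s.re) (h : HA L e dV hdV dW hdW)
    (hG : Integrable (fun u : ↥(unipDelta L e dV hdV dW hdW) =>
      conj (unipDeltaChar L e dV hdV dW hdW S (u : HA L e dV hdV dW hdW) : ℂ) * f s (weylDelta L e dV hdV dW hdW * (u : HA L e dV hdV dW hdW) * h)) νN)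
    (hJ : ∀ v, v ∉ kindWPlaces L e dV hdV dW hdW (T₀ : Set (HeightOneSpectrum (𝓞 (Fp L)))) S h →
      ∫ y, conj (unipDeltaChar L e dV hdV dW hdW S
            (locToAdelic L e dV hdV dW hdW v (y : UnitaryGroup.localPi L (IsCMField.complexConj L) (n + n) (hermD L e dV hdV dW hdW) v)) : ℂ) *
          LambdaLoc L e dV hdV dW hdW v χ s
            (UnitaryGroup.evalPlace (Fp L) L (IsCMField.complexConj L) (n + n) (hermD L e dV hdV dW hdW) v
                (UnitaryGroup.finPart (Fp L) L (IsCMField.complexConj L) (n + n) (hermD L e dV hdV dW hdW) (weylDelta L e dV hdV dW hdW)) *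
              (y : UnitaryGroup.localPi L (IsCMField.complexConj L) (n + n) (hermD L e dV hdV dW hdW) v)) ∂(νv v) =
        (1 - (v.residueCard : ℂ) ^ (-(2 * s + 1))) * (1 - (quadraticHeckeCharCM L).valueAtUniformizer v * (v.residueCard : ℂ) ^ (-(2 * s + 2)))) :
    whittakerDelta L e dV hdV dW hdW νN S (f s) h =
      kindWPart L e dV hdV dW hdW (kindWFinset L e dV hdV dW hdW T₀ S h) (νinf (kindWFinset L e dV hdV dW hdW T₀ S h)) νv
          (fT (kindWFinset L e dV hdV dW hdW T₀ S h)) S s h *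
        (partialStandardL (kindWPlaces L e dV hdV dW hdW (T₀ : Set (HeightOneSpectrum (𝓞 (Fp L)))) S h) (fun _ => {1}) (2 * s + 1) *
          partialStandardL (kindWPlaces L e dV hdV dW hdW (T₀ : Set (HeightOneSpectrum (𝓞 (Fp L)))) S h)
            (fun v => {(quadraticHeckeCharCM L).valueAtUniformizer v}) (2 * s + 2))⁻¹ := by
  -- ★ G1 at `T := U(S,h)` (as a `Finset`), its letters `hh hw hS hχ` read off §1
  have hout : ∀ v, v ∉ kindWFinset L e dV hdV dW hdW T₀ S h → v ∉ kindWPlaces L e dV hdV dW hdW (T₀ : Set (HeightOneSpectrum (𝓞 (Fp L)))) S h :=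
    fun v hv hv' => hv ((mem_kindWFinset L e dV hdV dW hdW).2 hv')
  haveI := hσ (kindWFinset L e dV hdV dW hdW T₀ S h)
  obtain ⟨-, hW⟩ := whittakerDelta_eq_mul_tprod_euler L e dV hdV dW hdW (kindWFinset L e dV hdV dW hdW T₀ S h) νN νv (fun v _ => hνK v)
    (νinf (kindWFinset L e dV hdV dW hdW T₀ S h)) (hmap _)
    (fun v hv => hχ v fun hv' => not_mem_of_not_mem_kindWPlaces L e dV hdV dW hdW (hout v hv) (Finset.mem_coe.2 hv'))
    (hfac _ (subset_kindWFinset L e dV hdV dW hdW T₀ S h)) s S (h := h)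
    (fun v hv => evalPlace_mem_localInt_of_not_mem_kindWPlaces L e dV hdV dW hdW (hout v hv))
    (fun v hv => weylDelta_mem_localInt_of_not_mem_kindWPlaces L e dV hdV dW hdW (hout v hv))
    (fun v hv w i j => integral_of_not_mem_kindWPlaces L e dV hdV dW hdW (hout v hv) w i j) hG
  -- ★ G2 at `U := ↑(kindWFinset T₀ S h) = U(S,h)`, fed by the per-place letter `hJ`
  have hE := tprod_whittaker_of_vol_eq_one (U := ((kindWFinset L e dV hdV dW hdW T₀ S h : Finset (HeightOneSpectrum (𝓞 (Fp L)))) : Set (HeightOneSpectrum (𝓞 (Fp L)))))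
    (Literature.RepresentationTheory.HarrisKudlaSweet1996.isFiniteOrder_quadraticHeckeCharCM (L := L)).isUnitary hs
    (W := fun v => ∫ y, conj (unipDeltaChar L e dV hdV dW hdW S
            (locToAdelic L e dV hdV dW hdW v (y : UnitaryGroup.localPi L (IsCMField.complexConj L) (n + n) (hermD L e dV hdV dW hdW) v)) : ℂ) *
          LambdaLoc L e dV hdV dW hdW v χ s
            (UnitaryGroup.evalPlace (Fp L) L (IsCMField.complexConj L) (n + n) (hermD L e dV hdV dW hdW) v
                (UnitaryGroup.finPart (Fp L) L (IsCMField.complexConj L) (n + n) (hermD L e dV hdV dW hdW) (weylDelta L e dV hdV dW hdW)) *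
              (y : UnitaryGroup.localPi L (IsCMField.complexConj L) (n + n) (hermD L e dV hdV dW hdW) v)) ∂(νv v))
    (fun v hv => hJ v fun hv' => hv (Finset.mem_coe.2 ((mem_kindWFinset L e dV hdV dW hdW).2 hv')))
  rw [hW, ← coe_kindWFinset L e dV hdV dW hdW T₀ S h, ← hE]
  rfl

end Euler


/-! ## §4 (edition 2) (W1) ∘ FUBINI: the Σ∏ presentation of KIND W on the half-plane of convergence -/

section SumProduct

variable [DecidableEq (HeightOneSpectrum (𝓞 (Fp L)))]
  [MeasurableSpace ↥(unipDelta L e dV hdV dW hdW)] [BorelSpace ↥(unipDelta L e dV hdV dW hdW)]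
  [MeasurableSpace ↥(unipDeltaArch L e dV hdV dW hdW)] [BorelSpace ↥(unipDeltaArch L e dV hdV dW hdW)]
  [∀ v : HeightOneSpectrum (𝓞 (Fp L)), MeasurableSpace ↥(unipDeltaLoc L e dV hdV dW hdW v)] [∀ v : HeightOneSpectrum (𝓞 (Fp L)), BorelSpace ↥(unipDeltaLoc L e dV hdV dW hdW v)]

set_option maxHeartbeats 800000 in -- MEASURED (as §3 `whittakerDelta_eq_kindWPart_mul` ∕ ★ G1, whose statement this one extends: default 200 000 times out at `whnf` of the statement); plain `rw` + `exact`, no search tactics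
/-- **(W1) ∘ FUBINI — THE Σ∏ PRESENTATION OF KIND W ON THE HALF-PLANE OF CONVERGENCE.**  Under the inputs of §3 `whittakerDelta_eq_kindWPart_mul` and, at
`T := U(S,h)` (`kindWFinset T₀ S h`), a finite-sum-of-pure-tensors structure of the `T`-part `fT_s(a, x) = Σ_{j<m} F_{∞,j}(s)(a) · ∏_{v∈T} F_{v,j}(s)(x_v)` (`hsum` — a
standard family is `K`-finite) with each summand's joint integrand integrable (`hint`):
`W_S(f_s)(h) = (Σ_j (∫ conj ψ_S(p_∞,1)·F_{∞,j}(s)(w_Δ p_∞ h_∞) dν_∞) · ∏_{v∈U(S,h)} ∫ conj ψ_S(ι_v y)·F_{v,j}(s)((w_Δ)_v y h_v) dν_v) · (ζ^U_{L⁺}(2s+1)·L^U(2s+2, ε_{L∕L⁺}))⁻¹`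
— §3 then ★ `jointWhittaker_eq_sum_mul_prod_of_sum_tensor`.  (The continued letter `A` of the TOP replaces each local INTEGRAL by its continued function: edition 3 ∕ (x-b).)
[cite: KudlaRallis1994, §1] [cite: Tan1999, §2–§3] [cite: CasselsFrohlichANT1967, Ch. XV Thm. 3.3.1] -/
theorem whittakerDelta_eq_sum_mul_prod_mul (T₀ : Finset (HeightOneSpectrum (𝓞 (Fp L))))
    (νN : Measure ↥(unipDelta L e dV hdV dW hdW))
    (νv : ∀ v : HeightOneSpectrum (𝓞 (Fp L)), Measure ↥(unipDeltaLoc L e dV hdV dW hdW v)) [∀ v, (νv v).IsHaarMeasure] [∀ v, SigmaFinite (νv v)]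
    (hνK : ∀ v, νv v (((inH (fun v => UnitaryGroup.localInt L (IsCMField.complexConj L) (n + n) (hermD L e dV hdV dW hdW) v)
      (fun v => unipDeltaLoc L e dV hdV dW hdW v) v) : Subgroup ↥(unipDeltaLoc L e dV hdV dW hdW v)) : Set ↥(unipDeltaLoc L e dV hdV dW hdW v)) = 1)
    (νinf : Finset (HeightOneSpectrum (𝓞 (Fp L))) → Measure ↥(unipDeltaArch L e dV hdV dW hdW)) (hσ : ∀ T, SigmaFinite (νinf T))
    (hmap : ∀ T : Finset (HeightOneSpectrum (𝓞 (Fp L))), Measure.map (unipDeltaSplitAt L e dV hdV dW hdW T) νN =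
      (νinf T).prod ((Measure.pi fun v : T => νv v.1).prod
        (rpMeasure (fun v : {v : HeightOneSpectrum (𝓞 (Fp L)) // v ∉ T} => ((inH (fun v => UnitaryGroup.localInt L (IsCMField.complexConj L) (n + n) (hermD L e dV hdV dW hdW) v)
          (fun v => unipDeltaLoc L e dV hdV dW hdW v) v.1 : Subgroup ↥(unipDeltaLoc L e dV hdV dW hdW v.1)) : Set ↥(unipDeltaLoc L e dV hdV dW hdW v.1))) (fun v => νv v.1) ∅)))
    {χ : HeckeCharacter L} (hχ : ∀ v, v ∉ T₀ → ∀ w' : UnitaryGroup.PlacesOver L v, χ.IsUnramifiedAt w'.1)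
    {f : ℂ → HA L e dV hdV dW hdW → ℂ}
    {fT : ∀ T : Finset (HeightOneSpectrum (𝓞 (Fp L))), ℂ → UnitaryGroup.arch (Fp L) L (IsCMField.complexConj L) (n + n) (hermD L e dV hdV dW hdW) ×
      (Π v : T, UnitaryGroup.localPi L (IsCMField.complexConj L) (n + n) (hermD L e dV hdV dW hdW) v.1) → ℂ}
    (hfac : ∀ T : Finset (HeightOneSpectrum (𝓞 (Fp L))), T₀ ⊆ T → IsFactorizableOff L e dV hdV dW hdW T χ f (fT T))
    (S : Matrix (Fin n) (Fin n) L) {s : ℂ} (hs : 0 < s.re) (h : HA L e dV hdV dW hdW)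
    (hG : Integrable (fun u : ↥(unipDelta L e dV hdV dW hdW) =>
      conj (unipDeltaChar L e dV hdV dW hdW S (u : HA L e dV hdV dW hdW) : ℂ) * f s (weylDelta L e dV hdV dW hdW * (u : HA L e dV hdV dW hdW) * h)) νN)
    (hJ : ∀ v, v ∉ kindWPlaces L e dV hdV dW hdW (T₀ : Set (HeightOneSpectrum (𝓞 (Fp L)))) S h →
      ∫ y, conj (unipDeltaChar L e dV hdV dW hdW S
            (locToAdelic L e dV hdV dW hdW v (y : UnitaryGroup.localPi L (IsCMField.complexConj L) (n + n) (hermD L e dV hdV dW hdW) v)) : ℂ) *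
          LambdaLoc L e dV hdV dW hdW v χ s
            (UnitaryGroup.evalPlace (Fp L) L (IsCMField.complexConj L) (n + n) (hermD L e dV hdV dW hdW) v
                (UnitaryGroup.finPart (Fp L) L (IsCMField.complexConj L) (n + n) (hermD L e dV hdV dW hdW) (weylDelta L e dV hdV dW hdW)) *
              (y : UnitaryGroup.localPi L (IsCMField.complexConj L) (n + n) (hermD L e dV hdV dW hdW) v)) ∂(νv v) =
        (1 - (v.residueCard : ℂ) ^ (-(2 * s + 1))) * (1 - (quadraticHeckeCharCM L).valueAtUniformizer v * (v.residueCard : ℂ) ^ (-(2 * s + 2))))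
    {m : ℕ} {Finf : Fin m → ℂ → UnitaryGroup.arch (Fp L) L (IsCMField.complexConj L) (n + n) (hermD L e dV hdV dW hdW) → ℂ}
    {Fv : Fin m → ∀ v : (kindWFinset L e dV hdV dW hdW T₀ S h), ℂ → UnitaryGroup.localPi L (IsCMField.complexConj L) (n + n) (hermD L e dV hdV dW hdW) v.1 → ℂ}
    (hsum : ∀ (s : ℂ) (a : UnitaryGroup.arch (Fp L) L (IsCMField.complexConj L) (n + n) (hermD L e dV hdV dW hdW)) (x : Π v : (kindWFinset L e dV hdV dW hdW T₀ S h), UnitaryGroup.localPi L (IsCMField.complexConj L) (n + n) (hermD L e dV hdV dW hdW) v.1),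
      fT (kindWFinset L e dV hdV dW hdW T₀ S h) s (a, x) = ∑ j, Finf j s a * ∏ v : (kindWFinset L e dV hdV dW hdW T₀ S h), Fv j v s (x v))
    (hint : ∀ j, Integrable (fun p : ↥(unipDeltaArch L e dV hdV dW hdW) × (Π v : (kindWFinset L e dV hdV dW hdW T₀ S h), ↥(unipDeltaLoc L e dV hdV dW hdW v.1)) =>
      (conj (unipDeltaChar L e dV hdV dW hdW S
            (UnitaryGroup.archToAdelic (Fp L) L (IsCMField.complexConj L) (n + n) (hermD L e dV hdV dW hdW)
              (p.1 : UnitaryGroup.arch (Fp L) L (IsCMField.complexConj L) (n + n) (hermD L e dV hdV dW hdW))) : ℂ) *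
          ∏ v : (kindWFinset L e dV hdV dW hdW T₀ S h), conj (unipDeltaChar L e dV hdV dW hdW S
            (locToAdelic L e dV hdV dW hdW v.1
              ((p.2 v : ↥(unipDeltaLoc L e dV hdV dW hdW v.1)) : UnitaryGroup.localPi L (IsCMField.complexConj L) (n + n) (hermD L e dV hdV dW hdW) v.1)) : ℂ)) *
        (Finf j s (UnitaryGroup.archPart (Fp L) L (IsCMField.complexConj L) (n + n) (hermD L e dV hdV dW hdW) (weylDelta L e dV hdV dW hdW) *
              (p.1 : UnitaryGroup.arch (Fp L) L (IsCMField.complexConj L) (n + n) (hermD L e dV hdV dW hdW)) *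
              UnitaryGroup.archPart (Fp L) L (IsCMField.complexConj L) (n + n) (hermD L e dV hdV dW hdW) h) *
          ∏ v : (kindWFinset L e dV hdV dW hdW T₀ S h), Fv j v s (UnitaryGroup.evalPlace (Fp L) L (IsCMField.complexConj L) (n + n) (hermD L e dV hdV dW hdW) v.1
                (UnitaryGroup.finPart (Fp L) L (IsCMField.complexConj L) (n + n) (hermD L e dV hdV dW hdW) (weylDelta L e dV hdV dW hdW)) *
              ((p.2 v : ↥(unipDeltaLoc L e dV hdV dW hdW v.1)) : UnitaryGroup.localPi L (IsCMField.complexConj L) (n + n) (hermD L e dV hdV dW hdW) v.1) *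
              UnitaryGroup.evalPlace (Fp L) L (IsCMField.complexConj L) (n + n) (hermD L e dV hdV dW hdW) v.1
                (UnitaryGroup.finPart (Fp L) L (IsCMField.complexConj L) (n + n) (hermD L e dV hdV dW hdW) h)))) ((νinf (kindWFinset L e dV hdV dW hdW T₀ S h)).prod (Measure.pi fun v : (kindWFinset L e dV hdV dW hdW T₀ S h) => νv v.1))) :
    whittakerDelta L e dV hdV dW hdW νN S (f s) h =
      (∑ j, (∫ a, conj (unipDeltaChar L e dV hdV dW hdW S
            (UnitaryGroup.archToAdelic (Fp L) L (IsCMField.complexConj L) (n + n) (hermD L e dV hdV dW hdW)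
              (a : UnitaryGroup.arch (Fp L) L (IsCMField.complexConj L) (n + n) (hermD L e dV hdV dW hdW))) : ℂ) *
          Finf j s (UnitaryGroup.archPart (Fp L) L (IsCMField.complexConj L) (n + n) (hermD L e dV hdV dW hdW) (weylDelta L e dV hdV dW hdW) *
              (a : UnitaryGroup.arch (Fp L) L (IsCMField.complexConj L) (n + n) (hermD L e dV hdV dW hdW)) *
              UnitaryGroup.archPart (Fp L) L (IsCMField.complexConj L) (n + n) (hermD L e dV hdV dW hdW) h) ∂(νinf (kindWFinset L e dV hdV dW hdW T₀ S h))) *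
        ∏ v : (kindWFinset L e dV hdV dW hdW T₀ S h), ∫ y, conj (unipDeltaChar L e dV hdV dW hdW S
            (locToAdelic L e dV hdV dW hdW v.1
              ((y : ↥(unipDeltaLoc L e dV hdV dW hdW v.1)) : UnitaryGroup.localPi L (IsCMField.complexConj L) (n + n) (hermD L e dV hdV dW hdW) v.1)) : ℂ) *
          Fv j v s (UnitaryGroup.evalPlace (Fp L) L (IsCMField.complexConj L) (n + n) (hermD L e dV hdV dW hdW) v.1
                (UnitaryGroup.finPart (Fp L) L (IsCMField.complexConj L) (n + n) (hermD L e dV hdV dW hdW) (weylDelta L e dV hdV dW hdW)) *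
              ((y : ↥(unipDeltaLoc L e dV hdV dW hdW v.1)) : UnitaryGroup.localPi L (IsCMField.complexConj L) (n + n) (hermD L e dV hdV dW hdW) v.1) *
              UnitaryGroup.evalPlace (Fp L) L (IsCMField.complexConj L) (n + n) (hermD L e dV hdV dW hdW) v.1
                (UnitaryGroup.finPart (Fp L) L (IsCMField.complexConj L) (n + n) (hermD L e dV hdV dW hdW) h)) ∂(νv v.1)) *
        (partialStandardL (kindWPlaces L e dV hdV dW hdW (T₀ : Set (HeightOneSpectrum (𝓞 (Fp L)))) S h) (fun _ => {1}) (2 * s + 1) *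
          partialStandardL (kindWPlaces L e dV hdV dW hdW (T₀ : Set (HeightOneSpectrum (𝓞 (Fp L)))) S h)
            (fun v => {(quadraticHeckeCharCM L).valueAtUniformizer v}) (2 * s + 2))⁻¹ := by
  haveI := hσ (kindWFinset L e dV hdV dW hdW T₀ S h)
  have hF := jointWhittaker_eq_sum_mul_prod_of_sum_tensor L e dV hdV dW hdW (kindWFinset L e dV hdV dW hdW T₀ S h) (νinf (kindWFinset L e dV hdV dW hdW T₀ S h)) νv hsum S s h hint
  rw [whittakerDelta_eq_kindWPart_mul L e dV hdV dW hdW T₀ νN νv hνK νinf hσ hmap hχ hfac S hs h hG hJ]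
  exact congrArg (· * _) hF

end SumProduct

end Summit.HodgeConjecture.HodgeConjecture.Cruxes.HLiu418.K2LiuSiegelEisensteinKindWLetters

end
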